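import Literature.Probability.RandomPlanarGeometry.HexSAWStripBridgeContactLLN
import HarnessLib

/-!
# The width-two strip at criticality: every surface-contact moment of the critical irreducible kernel of `S₂` is finite — trivially,
# the hat slices are EMPTY from `k = 2` on (module «WIDTH-TWO-MOMENTS»)

Topic `Literature/Probability/RandomPlanarGeometry` (a rider on «CONTACT-LLN» #750 `HexSAWStripBridgeContactLLN.lean` — `HV.widthTwo_contactSqIrr_eq_zero`,
`HV.widthTwo_summable_contactSqIrr` (= `hC2` at `T = 2`) — and «WIDTH-TWO-KERNEL» #715 `HexSAWStripWidthTwoKernel.lean` — `W2.hlen_of_mem_HBk_two`: an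
irreducible bridge of `S₂` has hat length `1` or `2`).  Lane «pcv-sawmu» (CriticalPhenomena venture), a-p2 g26 — the `T = 2` companion of «WIDTH-THREE-MOMENTS»
#1009 (`W3.widthThree_summable_contactPowIrr`): the `p`-th contact moment of the critical irreducible kernel along a hat class, `hCp`, the moment input of a
central limit theorem for the surface contacts (Feller XIII.6, second half; the abstract renewal-CLT car is not in the tree yet).  At `T = 2` the kernel is a
POLYNOMIAL (six irreducible bridges, #715), so every slice `k ≥ 2` is an empty sum and every moment is a finite sum.  Sources of the SETTING: H. Duminil-Copin,
A. Hammond, CMP 324 (2013) §2.2; W. Feller I (1968) XIII.6.  Nothing below is printed.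

* `widthTwo_contactPowIrr_eq_zero (p) (y) (hk : 2 ≤ k) (a b)` — the `p`-th contact slice of the irreducible kernel of `S₂` vanishes for `k ≥ 2`, at every `y`;
* ★ **`widthTwo_summable_contactPowIrr (p) (a b)`** — `hCp` at `T = 2` for every `p` (with #1009: `hCp` holds at `T = 2` AND `T = 3` for all `p`).

Label: LANE THEOREM (own, routine; a-p2 g26, 2026-08-27).  NOT claimed: the CLT; any `T ≥ 4`.
-/

noncomputable section

namespace Literature.Probability.RandomPlanarGeometry.SAW

open Finset Filter Topology Matrix BigOperators

namespace HV

/-- The `p`-th contact slice of the irreducible kernel of `S₂` is EMPTY from `k = 2` on: every irreducible bridge of `S₂` has hat length `1` or `2`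
(#715 `W2.hlen_of_mem_HBk_two`), while the slice `k` asks for hat length `2k + χ_a − χ_b ≥ 3`. (`p = 2` is #750's `widthTwo_contactSqIrr_eq_zero`.)
[cite: DuminilCopinHammond2013, §2.2; lane «pcv-sawmu» a-p2 g26] -/
theorem widthTwo_contactPowIrr_eq_zero (p : ℕ) (y : ℝ) {k : ℕ} (hk : 2 ≤ k) (a b : Fin (2 * 2)) :
    (∑ l ∈ LMset 2 (2 * k + 1) (hatLen k a b) (a : ℕ) (b : ℕ), (topCnt 2 l.tail : ℝ) ^ p * wD 2 y l) = 0 := by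
  refine sum_eq_zero fun l hl => ?_
  exfalso
  rw [LMset, mem_filter] at hl
  have hχa := (lchi_facts a).1
  have hχb := (lchi_facts b).1
  have hsz := hl.2
  unfold hatLen at hsz
  rcases W2.hlen_of_mem_HBk_two hl.1 with h | h <;> rw [h] at hsz <;> omega

/-- ★ **`hCp` at `T = 2` for every `p`**: the `p`-th contact moment of the critical irreducible kernel of `S₂` is (trivially) finite along every hat class —
the function is supported on `k < 2`.  With «WIDTH-THREE-MOMENTS» (`W3.widthThree_summable_contactPowIrr`) the moment hypothesis of a contact CLT holds at
`T = 2` and `T = 3` for all orders. [cite: Feller1968, XIII.6; DuminilCopinHammond2013, §2.2; lane «pcv-sawmu» a-p2 g26 — own result] -/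
theorem widthTwo_summable_contactPowIrr (p : ℕ) (a b : Fin (2 * 2)) :
    Summable fun k : ℕ => ∑ l ∈ LMset 2 (2 * k + 1) (hatLen k a b) (a : ℕ) (b : ℕ), (topCnt 2 l.tail : ℝ) ^ p * wD 2 (stripYT 2) l := by
  refine summable_of_ne_finset_zero (s := Finset.range 2) fun k hk => ?_
  rw [Finset.mem_range, not_lt] at hk
  exact widthTwo_contactPowIrr_eq_zero p (stripYT 2) hk a b

end HV

end Literature.Probability.RandomPlanarGeometry.SAW
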